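import Mathlib
import Summits.KontsevichZagierPeriods.KontsevichZagierPeriods.Theorems.InverseLandauTateFamilyKernelStubLinMoments
import Summits.KontsevichZagierPeriods.KontsevichZagierPeriods.Theorems.InverseLandauTateFamilyKernelStubGpDensity

/-!
# Crux `TateFamilyKernel` (stmt-KontsevichZagierPeriods-9130), line `Sketch`: `stub_twoFaceDensityZero`

Wave 14 (real analysis) of the lead's skeleton of the crux
`Summit.KontsevichZagierPeriods.KontsevichZagierPeriods.Theses.InverseLandau.TateFamilyKernel`:
**two-face density separation — a rational Stieltjes-type transform has zero density.**
If `B(ϖ)·[∫₀¹ fa/(1−ϖτa) + ∫₀¹ fb/(1−ϖτb)] = A(ϖ)` on `(0,b)` (`fa, fb` continuous, `τa, τb`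
continuous strictly increasing, `|τ|·b ≤ 1` on `[0,1]`, `B ≠ 0`), then `fa s = 0` if `τa s < τb 0`.

1. (clamp) extend the data continuously from `[0,1]` to `ℝ` (`Set.IccExtend`; same integrals);
2. (moments) `|ϖτ| ≤ ϖ/b < 1`, so `S(ϖ) = Σ_k M_k ϖ^k`, `M_k = ∫ fa τa^k + ∫ fb τb^k` (dominated
   convergence for series, `hasSum_face`); the Cauchy product with `B` (`hasSum_polynomial_mul`)
   and one-sided uniqueness of power-series coefficients (`eq_zero_of_hasSum_Ioo'`, from
   `LinMoments.eq_zero_of_hasSum_Ioo`) give `Σ_{j ≤ k} B_j M_{k−j} = A_k` for all `k`;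
3. (reversed polynomial) for `k = N + n + deg B`, `N = deg A + 1`:
   `∫ fa R(τa) τa^n + ∫ fb R(τb) τb^n = 0`, `R = B̃·X^N ≠ 0` (`sum_coeff_mul_integral`);
4. (Weierstrass) the pairing `g ↦ ∫ fa R(τa) g(τa) + ∫ fb R(τb) g(τb)` kills monomials, hence
   polynomials, hence (uniform approximation on `[−1/b, 1/b]`) every continuous `g`
   (`pairing_continuous_eq_zero`);
5. (separation) with the clamped inverse `e` of `τa` (`GpDensity.exists_extendedInverse`) and
   `g(u) = ha(e u)·max(0, τb 0 − u)`, `ha = fa R(τa)`: `g(τb s) = 0` and `g(τa s) = ha(s)·max(…)`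
   on `[0,1]`, so `∫₀¹ ha²·max(0, τb 0 − τa) = 0` with a continuous integrand `≥ 0`, which
   therefore vanishes on `[0,1]`: `ha s = 0` whenever `τa s < τb 0`;
6. (finitely many bad points) if `fa s₀ ≠ 0`, then `R(τa s) = 0` on a relative neighbourhood of
   `s₀` in `[0,1]`, an infinite set — but `τa` is injective and `R` has finitely many roots.

References: Kontsevich–Zagier 2001, §1.2; moment determinacy on a compact interval (folklore).
Mathlib plus the two landed helpers; no named fact, no new definition; helpers in the
sub-namespace `TwoFaceDensityZero`.
-/

noncomputable section

open MeasureTheory Set MvPolynomial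
open scoped Topology

namespace Summit.KontsevichZagierPeriods.InverseLandau.TateFamilyKernel.Descent

namespace TwoFaceDensityZero

/-! ### Power series -/

/-- **One-sided uniqueness of power-series coefficients, summable form.** If `Σ_M μ_M ϖ^M = 0`
for every `ϖ ∈ (0,b)` (`0 < b`), then all `μ_M = 0`: convergence at `ϖ₀ = b/2` bounds
`|μ_M| ≤ C (2/b)^M`, and `LinMoments.eq_zero_of_hasSum_Ioo` applies. [folklore] -/
theorem eq_zero_of_hasSum_Ioo' {μ : ℕ → ℝ} {b : ℝ} (hb : 0 < b)
    (hsum : ∀ ϖ ∈ Ioo 0 b, HasSum (fun M => μ M * ϖ ^ M) 0) (M : ℕ) : μ M = 0 := by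
  have hϖ₀ : b / 2 ∈ Ioo 0 b := ⟨by positivity, by linarith⟩
  obtain ⟨C, hC⟩ := ((hsum _ hϖ₀).summable.tendsto_atTop_zero.abs).bddAbove_range
  refine LinMoments.eq_zero_of_hasSum_Ioo (C := C) (R := (b / 2)⁻¹) (inv_pos.2 hϖ₀.1) hb
    (fun n => ?_) hsum M
  have h : |μ n * (b / 2) ^ n| ≤ C := hC (Set.mem_range_self n)
  rw [abs_mul, abs_pow, abs_of_pos hϖ₀.1] at h
  rwa [inv_pow, ← div_eq_mul_inv, le_div_iff₀ (pow_pos hϖ₀.1 n)]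

/-- A polynomial is the sum of its own (finite) power series. [folklore] -/
theorem hasSum_polynomial_eval (A : Polynomial ℝ) (ϖ : ℝ) :
    HasSum (fun k => A.coeff k * ϖ ^ k) (A.eval ϖ) := by
  rw [Polynomial.eval_eq_sum_range]
  refine hasSum_sum_of_ne_finset_zero fun k hk => ?_
  rw [Finset.mem_range, not_lt] at hk
  rw [Polynomial.coeff_eq_zero_of_natDegree_lt (Nat.lt_of_succ_le hk), zero_mul]

/-- **Cauchy product of a polynomial with a power series.** If `Σ_k M_k ϖ^k = S`, then
`Σ_k (Σ_{j ≤ k} B_j M_{k−j}) ϖ^k = B(ϖ)·S` (induction on `B`: additivity and the shift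
`hasSum_nat_add_iff'` for a monomial). [folklore] -/
theorem hasSum_polynomial_mul {M : ℕ → ℝ} {ϖ S : ℝ} (hS : HasSum (fun k => M k * ϖ ^ k) S)
    (B : Polynomial ℝ) :
    HasSum (fun k => (∑ j ∈ Finset.range (k + 1), B.coeff j * M (k - j)) * ϖ ^ k)
      (B.eval ϖ * S) := by
  induction B using Polynomial.induction_on' with
  | add p q hp hq =>
    simp only [Polynomial.coeff_add, Polynomial.eval_add, add_mul, Finset.sum_add_distrib]
    exact hp.add hq
  | monomial j c =>
    simp only [Polynomial.coeff_monomial, Polynomial.eval_monomial]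
    have h1 : ∀ k, (∑ x ∈ Finset.range (k + 1), (if j = x then c else 0) * M (k - x)) * ϖ ^ k =
        if j ≤ k then c * M (k - j) * ϖ ^ k else 0 := fun k => by
      simp_rw [ite_mul, zero_mul, Finset.sum_ite_eq, Finset.mem_range, Nat.lt_succ_iff, ite_mul,
        zero_mul]
    simp_rw [h1]
    refine (hasSum_nat_add_iff' j).1 ?_
    have h3 : ∑ i ∈ Finset.range j, (if j ≤ i then c * M (i - j) * ϖ ^ i else 0) = 0 :=
      Finset.sum_eq_zero fun i hi => if_neg (not_le.2 (Finset.mem_range.1 hi))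
    have h4 : ∀ n, (if j ≤ n + j then c * M (n + j - j) * ϖ ^ (n + j) else 0) =
        c * ϖ ^ j * (M n * ϖ ^ n) := fun n => by
      rw [if_pos (Nat.le_add_left j n), Nat.add_sub_cancel, pow_add]
      ring
    rw [h3, sub_zero]
    simp_rw [h4]
    exact hS.mul_left (c * ϖ ^ j)

/-- **Geometric expansion of one face integral.** For continuous `f, τ` with `|ϖτ| ≤ q < 1` on
`[0,1]`: `Σ_k (∫₀¹ f τ^k) ϖ^k = ∫₀¹ f/(1 − ϖτ)` (dominated convergence for series with the
uniform bound `‖f‖ q^k`). [folklore] -/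
theorem hasSum_face {f τ : ℝ → ℝ} (hf : Continuous f) (hτ : Continuous τ) {ϖ q : ℝ}
    (hq0 : 0 ≤ q) (hq1 : q < 1) (hbd : ∀ s ∈ Icc (0 : ℝ) 1, |ϖ * τ s| ≤ q) :
    HasSum (fun k => (∫ s in (0 : ℝ)..1, f s * τ s ^ k) * ϖ ^ k)
      (∫ s in (0 : ℝ)..1, f s / (1 - ϖ * τ s)) := by
  have hI : ∀ s ∈ Set.uIoc (0 : ℝ) 1, s ∈ Icc (0 : ℝ) 1 := fun s hs =>
    Ioc_subset_Icc_self ((uIoc_of_le zero_le_one (α := ℝ)) ▸ hs)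
  simp_rw [← intervalIntegral.integral_mul_const]
  refine intervalIntegral.hasSum_integral_of_dominated_convergence (fun k s => ‖f s‖ * q ^ k)
    (fun k => (((hf.mul (hτ.pow k)).mul continuous_const).aestronglyMeasurable).restrict)
    (fun k => Filter.Eventually.of_forall fun s hs => ?_)
    (Filter.Eventually.of_forall fun s _ => (summable_geometric_of_lt_one hq0 hq1).mul_left _)
    ?_ (Filter.Eventually.of_forall fun s hs => ?_)
  · rw [norm_mul, norm_mul, norm_pow, norm_pow, mul_assoc, ← mul_pow]
    refine mul_le_mul_of_nonneg_left (pow_le_pow_left₀ (by positivity) ?_ k) (norm_nonneg _)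
    rw [Real.norm_eq_abs, Real.norm_eq_abs, ← abs_mul, mul_comm]
    exact hbd s (hI s hs)
  · simp_rw [tsum_mul_left, tsum_geometric_of_lt_one hq0 hq1]
    exact (hf.norm.mul continuous_const).intervalIntegrable _ _
  · have h4 : ∀ k, f s * τ s ^ k * ϖ ^ k = f s * (ϖ * τ s) ^ k := fun k => by
      rw [mul_pow]; ring
    simp_rw [h4, div_eq_mul_inv]
    exact (hasSum_geometric_of_abs_lt_one ((hbd s (hI s hs)).trans_lt hq1)).mul_left (f s)

/-! ### The reversed polynomial and the shifted moments -/

/-- Evaluation of the reversed polynomial: `B̃(u) = Σ_{j ≤ deg B} B_j u^{deg B − j}`. [folklore] -/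
theorem eval_reverse_eq_sum (B : Polynomial ℝ) (u : ℝ) :
    B.reverse.eval u =
      ∑ j ∈ Finset.range (B.natDegree + 1), B.coeff j * u ^ (B.natDegree - j) := by
  rw [Polynomial.eval_eq_sum_range' (Nat.lt_succ_of_le B.reverse_natDegree_le)]
  conv_lhs => rw [← Finset.sum_range_reflect]
  refine Finset.sum_congr rfl fun j hj => ?_
  have hj' : j ≤ B.natDegree := Nat.lt_succ_iff.mp (Finset.mem_range.mp hj)
  rw [Nat.succ_sub_one, Polynomial.coeff_reverse, Polynomial.revAt_le (Nat.sub_le _ _),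
    Nat.sub_sub_self hj']

/-- The shifted moment combination is the `n`-th moment of `f·R(τ)`, `R = B̃·X^N`:
`Σ_{j ≤ deg B} B_j ∫₀¹ f τ^{N+n+deg B−j} = ∫₀¹ f·R(τ)·τ^n`. [folklore] -/
theorem sum_coeff_mul_integral {f τ : ℝ → ℝ} (hf : Continuous f) (hτ : Continuous τ)
    (B : Polynomial ℝ) (N n : ℕ) :
    ∑ j ∈ Finset.range (B.natDegree + 1),
        B.coeff j * ∫ s in (0 : ℝ)..1, f s * τ s ^ (N + n + B.natDegree - j) =
      ∫ s in (0 : ℝ)..1, f s * ((B.reverse * Polynomial.X ^ N).eval (τ s) * τ s ^ n) := by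
  have hint : ∀ j ∈ Finset.range (B.natDegree + 1), IntervalIntegrable
      (fun s => B.coeff j * (f s * τ s ^ (N + n + B.natDegree - j))) volume (0 : ℝ) 1 :=
    fun j _ => (continuous_const.mul (hf.mul (hτ.pow _))).intervalIntegrable _ _
  simp_rw [← intervalIntegral.integral_const_mul]
  rw [← intervalIntegral.integral_finsetSum hint]
  refine intervalIntegral.integral_congr fun s _ => ?_
  simp only [Polynomial.eval_mul, Polynomial.eval_pow, Polynomial.eval_X, eval_reverse_eq_sum,
    Finset.sum_mul, Finset.mul_sum]
  refine Finset.sum_congr rfl fun j hj => ?_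
  rw [Nat.add_sub_assoc (Nat.lt_succ_iff.mp (Finset.mem_range.mp hj)), pow_add, pow_add]
  ring

/-! ### Weierstrass: from monomial to continuous test functions -/

/-- **Weierstrass upgrade.** If the two-face pairing `g ↦ ∫₀¹ ha·g(τa) + ∫₀¹ hb·g(τb)` vanishes
on all monomials and both ranges `τa([0,1])`, `τb([0,1])` lie in `[−L, L]`, then it vanishes on
every continuous test function `g`: linearity gives polynomials, and uniform polynomial
approximation on `[−L, L]` (`exists_polynomial_near_of_continuousOn`) the rest. [folklore] -/
theorem pairing_continuous_eq_zero {ha hb τa τb : ℝ → ℝ} (hha : Continuous ha)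
    (hhb : Continuous hb) (hτa : Continuous τa) (hτb : Continuous τb) {L : ℝ}
    (hra : ∀ s ∈ Icc (0 : ℝ) 1, τa s ∈ Icc (-L) L) (hrb : ∀ s ∈ Icc (0 : ℝ) 1, τb s ∈ Icc (-L) L)
    (hmom : ∀ n : ℕ,
      (∫ s in (0 : ℝ)..1, ha s * τa s ^ n) + ∫ s in (0 : ℝ)..1, hb s * τb s ^ n = 0)
    {g : ℝ → ℝ} (hg : Continuous g) :
    (∫ s in (0 : ℝ)..1, ha s * g (τa s)) + ∫ s in (0 : ℝ)..1, hb s * g (τb s) = 0 := by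
  have hI : ∀ {h τ : ℝ → ℝ}, Continuous h → Continuous τ → ∀ {φ : ℝ → ℝ}, Continuous φ →
      IntervalIntegrable (fun s => h s * φ (τ s)) volume (0 : ℝ) 1 :=
    fun hh hτ _ hφ => (hh.mul (hφ.comp hτ)).intervalIntegrable _ _
  -- polynomial test functions
  have hpoly : ∀ p : Polynomial ℝ,
      (∫ s in (0 : ℝ)..1, ha s * p.eval (τa s)) + ∫ s in (0 : ℝ)..1, hb s * p.eval (τb s) = 0 := by
    intro p
    induction p using Polynomial.induction_on' with
    | add p q hp hq =>
      simp only [Polynomial.eval_add, mul_add]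
      rw [intervalIntegral.integral_add (hI hha hτa p.continuous) (hI hha hτa q.continuous),
        intervalIntegral.integral_add (hI hhb hτb p.continuous) (hI hhb hτb q.continuous)]
      linarith
    | monomial n c =>
      have e1 : ∀ h τ : ℝ → ℝ, (fun s => h s * (Polynomial.monomial n c).eval (τ s)) =
          fun s => c * (h s * τ s ^ n) := fun h τ => funext fun s => by
        rw [Polynomial.eval_monomial]
        ring
      rw [e1, e1, intervalIntegral.integral_const_mul, intervalIntegral.integral_const_mul,
        ← mul_add, hmom n, mul_zero]
  -- sup bounds and the one-face error bound
  obtain ⟨Ca, hCa⟩ := isCompact_Icc.exists_bound_of_continuousOn (hha.continuousOn (s := Icc 0 1))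
  obtain ⟨Cb, hCb⟩ := isCompact_Icc.exists_bound_of_continuousOn (hhb.continuousOn (s := Icc 0 1))
  have hbd : ∀ {h τ : ℝ → ℝ} {C δ : ℝ} {p : Polynomial ℝ}, (∀ x ∈ Icc (0 : ℝ) 1, ‖h x‖ ≤ C) →
      (∀ s ∈ Icc (0 : ℝ) 1, τ s ∈ Icc (-L) L) → (∀ x ∈ Icc (-L) L, |p.eval x - g x| < δ) →
      |∫ s in (0 : ℝ)..1, h s * (g (τ s) - p.eval (τ s))| ≤ C * δ := by
    intro h τ C δ p hC hr hp
    have key := intervalIntegral.norm_integral_le_of_norm_le_const (a := (0 : ℝ)) (b := 1)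
      (C := C * δ) (f := fun s => h s * (g (τ s) - p.eval (τ s))) fun x hx => by
        rw [uIoc_of_le zero_le_one] at hx
        rw [norm_mul]
        refine mul_le_mul (hC x (Ioc_subset_Icc_self hx)) ?_ (norm_nonneg _)
          ((norm_nonneg _).trans (hC x (Ioc_subset_Icc_self hx)))
        rw [Real.norm_eq_abs, abs_sub_comm]
        exact (hp _ (hr x (Ioc_subset_Icc_self hx))).le
    rwa [sub_zero, abs_one, mul_one, Real.norm_eq_abs] at key
  -- `|pairing g| ≤ (Ca + Cb) δ` for every `δ > 0`
  have key : ∀ δ ∈ Ioi (0 : ℝ),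
      |(∫ s in (0 : ℝ)..1, ha s * g (τa s)) + ∫ s in (0 : ℝ)..1, hb s * g (τb s)| ≤
        (Ca + Cb) * δ := by
    intro δ hδ
    obtain ⟨p, hp⟩ := exists_polynomial_near_of_continuousOn (-L) L g hg.continuousOn δ hδ
    have hsplit : (∫ s in (0 : ℝ)..1, ha s * g (τa s)) + ∫ s in (0 : ℝ)..1, hb s * g (τb s) =
        (∫ s in (0 : ℝ)..1, ha s * (g (τa s) - p.eval (τa s))) +
          ∫ s in (0 : ℝ)..1, hb s * (g (τb s) - p.eval (τb s)) := by
      simp_rw [mul_sub]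
      rw [intervalIntegral.integral_sub (hI hha hτa hg) (hI hha hτa p.continuous),
        intervalIntegral.integral_sub (hI hhb hτb hg) (hI hhb hτb p.continuous)]
      linarith [hpoly p]
    rw [hsplit, add_mul]
    exact (abs_add_le _ _).trans (add_le_add (hbd hCa hra hp) (hbd hCb hrb hp))
  have ht : Filter.Tendsto (fun δ : ℝ => (Ca + Cb) * δ) (𝓝[>] 0) (𝓝 0) :=
    tendsto_nhdsWithin_of_tendsto_nhds (by simpa using (continuous_const_mul (Ca + Cb)).tendsto 0)
  exact abs_nonpos_iff.1 (ge_of_tendsto ht (eventually_nhdsWithin_of_forall key))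

/-! ### The statement for continuous data on `ℝ` -/

/-- **Two-face density separation, continuous data.** The statement of `stub_twoFaceDensityZero`
for `fa, fb, τa, τb` continuous on all of `ℝ` and `τb` merely monotone on `[0,1]` (steps 2–6 of
the module docstring). [folklore] -/
theorem of_continuous {fa fb τa τb : ℝ → ℝ} {b : ℝ} (hb : 0 < b)
    (hfa : Continuous fa) (hfb : Continuous fb) (hτa : Continuous τa) (hτb : Continuous τb)
    (hma : StrictMonoOn τa (Icc 0 1)) (hmb : MonotoneOn τb (Icc 0 1))
    (hbd : ∀ s ∈ Icc (0 : ℝ) 1, |τa s| * b ≤ 1 ∧ |τb s| * b ≤ 1)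
    {A B : Polynomial ℝ} (hB : B ≠ 0)
    (hid : ∀ ϖ ∈ Ioo 0 b, B.eval ϖ *
      ((∫ s in (0 : ℝ)..1, fa s / (1 - ϖ * τa s)) + ∫ s in (0 : ℝ)..1, fb s / (1 - ϖ * τb s)) =
        A.eval ϖ)
    {s₀ : ℝ} (hs₀ : s₀ ∈ Icc (0 : ℝ) 1) (hlt : τa s₀ < τb 0) : fa s₀ = 0 := by
  -- ranges: `|τ| ≤ 1/b` on `[0,1]`
  have hrg : ∀ {t : ℝ}, |t| * b ≤ 1 → |t| ≤ b⁻¹ := fun h => by rwa [← one_div, le_div_iff₀ hb]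
  -- Step 2: the moment series and the coefficient identities `Σ_{j ≤ k} B_j M_{k-j} = A_k`
  obtain ⟨M, hM⟩ : ∃ M : ℕ → ℝ, M = fun k =>
      (∫ s in (0 : ℝ)..1, fa s * τa s ^ k) + ∫ s in (0 : ℝ)..1, fb s * τb s ^ k := ⟨_, rfl⟩
  have hc : ∀ k, (∑ j ∈ Finset.range (k + 1), B.coeff j * M (k - j)) - A.coeff k = 0 := by
    refine eq_zero_of_hasSum_Ioo' hb fun ϖ hϖ => ?_
    have hq1 : ϖ * b⁻¹ < 1 := by rw [← div_eq_mul_inv, div_lt_one hb]; exact hϖ.2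
    have hbd' : ∀ {τ : ℝ → ℝ}, (∀ s ∈ Icc (0 : ℝ) 1, |τ s| * b ≤ 1) →
        ∀ s ∈ Icc (0 : ℝ) 1, |ϖ * τ s| ≤ ϖ * b⁻¹ := fun h s hs => by
      rw [abs_mul, abs_of_pos hϖ.1]
      exact mul_le_mul_of_nonneg_left (hrg (h s hs)) hϖ.1.le
    have hS : HasSum (fun k => M k * ϖ ^ k) ((∫ s in (0 : ℝ)..1, fa s / (1 - ϖ * τa s)) +
        ∫ s in (0 : ℝ)..1, fb s / (1 - ϖ * τb s)) := by
      rw [hM]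
      simp_rw [add_mul]
      have hq0 : 0 ≤ ϖ * b⁻¹ := mul_nonneg hϖ.1.le (inv_nonneg.2 hb.le)
      exact (hasSum_face hfa hτa hq0 hq1 (hbd' fun s hs => (hbd s hs).1)).add
        (hasSum_face hfb hτb hq0 hq1 (hbd' fun s hs => (hbd s hs).2))
    have h3 := (hasSum_polynomial_mul hS B).sub (hasSum_polynomial_eval A ϖ)
    rw [hid ϖ hϖ, sub_self] at h3
    simpa only [sub_mul] using h3
  -- Step 3: the moments of `fa·R(τa)`, `fb·R(τb)` vanish, `R = B̃·X^(deg A + 1) ≠ 0`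
  obtain ⟨R, hR⟩ : ∃ R : Polynomial ℝ, R = B.reverse * Polynomial.X ^ (A.natDegree + 1) := ⟨_, rfl⟩
  have hR0 : R ≠ 0 := hR ▸ mul_ne_zero (fun h => hB (Polynomial.reverse_eq_zero.1 h))
    (pow_ne_zero _ Polynomial.X_ne_zero)
  have hmom : ∀ n : ℕ, (∫ s in (0 : ℝ)..1, fa s * R.eval (τa s) * τa s ^ n) +
      ∫ s in (0 : ℝ)..1, fb s * R.eval (τb s) * τb s ^ n = 0 := by
    intro n
    have h := hc (A.natDegree + 1 + n + B.natDegree)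
    have hA : A.coeff (A.natDegree + 1 + n + B.natDegree) = 0 :=
      Polynomial.coeff_eq_zero_of_natDegree_lt (by omega)
    have hcut : ∑ j ∈ Finset.range (A.natDegree + 1 + n + B.natDegree + 1),
        B.coeff j * M (A.natDegree + 1 + n + B.natDegree - j) =
        ∑ j ∈ Finset.range (B.natDegree + 1),
          B.coeff j * M (A.natDegree + 1 + n + B.natDegree - j) :=
      Finset.eventually_constant_sum (fun j hj => by
        rw [Polynomial.coeff_eq_zero_of_natDegree_lt (by omega), zero_mul]) (by omega)
    rw [hA, sub_zero, hcut, hM] at h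
    simp only [mul_add, Finset.sum_add_distrib] at h
    rw [sum_coeff_mul_integral hfa hτa B _ n, sum_coeff_mul_integral hfb hτb B _ n, ← hR] at h
    simpa only [mul_assoc] using h
  -- Step 4/5: Weierstrass with the test function `g u = ha (ea u) · max 0 (τb 0 - u)`
  have hha : Continuous fun s => fa s * R.eval (τa s) := hfa.mul (R.continuous.comp hτa)
  obtain ⟨ea, hea_cont, -, -, hea_U, -, -⟩ := GpDensity.exists_extendedInverse hτa hma
  obtain ⟨F, hF⟩ : ∃ F : ℝ → ℝ, F = fun s =>
      fa s * R.eval (τa s) * (fa s * R.eval (τa s)) * max 0 (τb 0 - τa s) := ⟨_, rfl⟩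
  have hF_cont : Continuous F :=
    hF ▸ (hha.mul hha).mul (continuous_const.max (continuous_const.sub hτa))
  have hF_int : ∫ s in (0 : ℝ)..1, F s = 0 := by
    have h : (∫ s in (0 : ℝ)..1, fa s * R.eval (τa s) *
        (fa (ea (τa s)) * R.eval (τa (ea (τa s))) * max 0 (τb 0 - τa s))) +
        ∫ s in (0 : ℝ)..1, fb s * R.eval (τb s) *
          (fa (ea (τb s)) * R.eval (τa (ea (τb s))) * max 0 (τb 0 - τb s)) = 0 :=
      pairing_continuous_eq_zero hha (hfb.mul (R.continuous.comp hτb)) hτa hτb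
        (fun s hs => abs_le.1 (hrg (hbd s hs).1)) (fun s hs => abs_le.1 (hrg (hbd s hs).2)) hmom
        (g := fun u => fa (ea u) * R.eval (τa (ea u)) * max 0 (τb 0 - u))
        ((hha.comp hea_cont).mul (continuous_const.max (continuous_const.sub continuous_id)))
    have hIb : ∫ s in (0 : ℝ)..1, fb s * R.eval (τb s) *
        (fa (ea (τb s)) * R.eval (τa (ea (τb s))) * max 0 (τb 0 - τb s)) =
        ∫ _ in (0 : ℝ)..1, (0 : ℝ) := by
      refine intervalIntegral.integral_congr fun s hs => ?_
      rw [uIcc_of_le zero_le_one] at hs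
      have hle : τb 0 ≤ τb s := hmb (left_mem_Icc.2 zero_le_one) hs hs.1
      simp only [max_eq_left (sub_nonpos.2 hle), mul_zero]
    have hIa : ∫ s in (0 : ℝ)..1, fa s * R.eval (τa s) *
        (fa (ea (τa s)) * R.eval (τa (ea (τa s))) * max 0 (τb 0 - τa s)) =
        ∫ s in (0 : ℝ)..1, F s := by
      refine intervalIntegral.integral_congr fun s hs => ?_
      rw [uIcc_of_le zero_le_one] at hs
      simp only [hF, hea_U s hs, mul_assoc]
    rwa [hIa, hIb, intervalIntegral.integral_zero, add_zero] at h
  have hF_zero : ∀ s ∈ Icc (0 : ℝ) 1, F s = 0 := by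
    intro s hs
    by_contra hne
    have hne' : (Ioo (0 : ℝ) 1 ∩ Function.support F).Nonempty :=
      (closure_inter_open_nonempty_iff hF_cont.isOpen_support).1
        ⟨s, by rwa [closure_Ioo zero_ne_one], Function.mem_support.2 hne⟩
    have hpos : 0 < ∫ x in (0 : ℝ)..1, F x := by
      rw [intervalIntegral.integral_pos_iff_support_of_nonneg_ae (Filter.Eventually.of_forall
        fun s => by rw [hF]; exact mul_nonneg (mul_self_nonneg _) (le_max_left _ _))
        (hF_cont.intervalIntegrable 0 1)]
      exact ⟨zero_lt_one, ((isOpen_Ioo.inter hF_cont.isOpen_support).measure_pos volume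
        hne').trans_le (measure_mono fun x hx => ⟨hx.2, Ioo_subset_Ioc_self hx.1⟩)⟩
    exact hpos.ne' hF_int
  have hha0 : ∀ s ∈ Icc (0 : ℝ) 1, τa s < τb 0 → fa s * R.eval (τa s) = 0 := by
    intro s hs hlt'
    have h := hF_zero s hs
    simp only [hF] at h
    rcases mul_eq_zero.1 h with h | h
    · exact mul_self_eq_zero.1 h
    · exact absurd h (lt_max_of_lt_right (sub_pos.2 hlt')).ne'
  -- Step 6: `fa s₀ ≠ 0` would force `R (τa s) = 0` on an infinite subset of `[0,1]`
  by_contra hne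
  obtain ⟨l, u, hlu, hsub⟩ := mem_nhds_iff_exists_Ioo_subset.1
    ((hfa.continuousAt.eventually_ne hne).and
      (Filter.Tendsto.eventually_lt_const hlt hτa.continuousAt))
  have hfin : {s | s ∈ Icc (0 : ℝ) 1 ∧ R.IsRoot (τa s)}.Finite :=
    Set.Finite.of_finite_image ((Polynomial.finite_setOf_isRoot hR0).subset
      (by rintro _ ⟨s, hs, rfl⟩; exact hs.2)) (hma.injOn.mono fun s hs => hs.1)
  refine Ioo_infinite (a := max l 0) (b := min u 1) ?_ (hfin.subset fun s hs => ?_)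
  · rw [max_lt_iff, lt_min_iff, lt_min_iff]
    exact ⟨⟨hlu.1.trans hlu.2, by linarith [hlu.1, hs₀.2]⟩, by linarith [hlu.2, hs₀.1],
      zero_lt_one⟩
  · rw [mem_Ioo, max_lt_iff, lt_min_iff] at hs
    have hs01 : s ∈ Icc (0 : ℝ) 1 := ⟨hs.1.2.le, hs.2.2.le⟩
    have h := hsub ⟨hs.1.1, hs.2.1⟩
    exact ⟨hs01, (mul_eq_zero.1 (hha0 s hs01 h.2)).resolve_left h.1⟩

end TwoFaceDensityZero

open TwoFaceDensityZero in
/-- **Stub `stub_twoFaceDensityZero`** (wave 14, real analysis). **Two-face density separation: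
a rational Stieltjes-type transform has zero density.** Let `fa, fb` be continuous on `[0,1]`,
`τa, τb` continuous and strictly increasing on `[0,1]` with `|τ|·b ≤ 1`, and suppose
`B(ϖ)·[∫₀¹ fa/(1−ϖτa) + ∫₀¹ fb/(1−ϖτb)] = A(ϖ)` on `(0,b)` for real polynomials `A`, `B ≠ 0`.
Then `fa(s) = 0` whenever `τa(s) < τb(0)`. Proof: extend the data continuously from `[0,1]` to
`ℝ` (`Set.IccExtend`, same integrals) and apply `TwoFaceDensityZero.of_continuous`: expand
geometrically, `M_k = ∫ faτa^k + ∫ fbτb^k`; `B·Σ M_kϖ^k = A` forces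
`∫ fa·R(τa)τa^n + ∫ fb·R(τb)τb^n = 0` for all `n` (`R = B̃·X^{deg A+1}`, `B̃` the reversed
polynomial); Weierstrass upgrades `u^n` to every continuous `g(u)`; test functions supported below
`τb(0)` see only the `a`-term; the clamped inverse of `τa` localises; continuity removes the
finitely many zeros of `R(τa)`.
[cite: KontsevichZagier2001, §1.2] [folklore: Stieltjes/moment determinacy on a compact interval] -/
theorem stub_twoFaceDensityZero (fa fb τa τb : ℝ → ℝ) (b : ℝ) (hb : 0 < b)
    (hfa : ContinuousOn fa (Icc 0 1)) (hfb : ContinuousOn fb (Icc 0 1))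
    (hτa : ContinuousOn τa (Icc 0 1)) (hτb : ContinuousOn τb (Icc 0 1))
    (hma : StrictMonoOn τa (Icc 0 1)) (hmb : StrictMonoOn τb (Icc 0 1))
    (hbd : ∀ s ∈ Icc (0 : ℝ) 1, |τa s| * b ≤ 1 ∧ |τb s| * b ≤ 1)
    (A B : Polynomial ℝ) (hB : B ≠ 0)
    (hid : ∀ ϖ ∈ Ioo 0 b, B.eval ϖ *
      ((∫ s in (0 : ℝ)..1, fa s / (1 - ϖ * τa s)) + ∫ s in (0 : ℝ)..1, fb s / (1 - ϖ * τb s)) = A.eval ϖ) :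
    ∀ s ∈ Icc (0 : ℝ) 1, τa s < τb 0 → fa s = 0 := by
  -- continuous extensions of the data from `[0,1]` to `ℝ`
  have key : ∀ {f : ℝ → ℝ}, ContinuousOn f (Icc 0 1) →
      ∃ g : ℝ → ℝ, Continuous g ∧ EqOn f g (Icc 0 1) := fun {f} hf =>
    ⟨IccExtend zero_le_one ((Icc (0 : ℝ) 1).restrict f), hf.restrict.Icc_extend',
      fun x hx => (IccExtend_of_mem zero_le_one ((Icc (0 : ℝ) 1).restrict f) hx).symm⟩
  obtain ⟨Fa, hFa, eFa⟩ := key hfa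
  obtain ⟨Fb, hFb, eFb⟩ := key hfb
  obtain ⟨Ta, hTa, eTa⟩ := key hτa
  obtain ⟨Tb, hTb, eTb⟩ := key hτb
  have h01 : (0 : ℝ) ∈ Icc (0 : ℝ) 1 := left_mem_Icc.2 zero_le_one
  have hint : ∀ {f F τ T : ℝ → ℝ}, EqOn f F (Icc 0 1) → EqOn τ T (Icc 0 1) → ∀ ϖ : ℝ,
      ∫ s in (0 : ℝ)..1, f s / (1 - ϖ * τ s) = ∫ s in (0 : ℝ)..1, F s / (1 - ϖ * T s) :=
    fun ef eτ ϖ => intervalIntegral.integral_congr fun s hs => by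
      rw [uIcc_of_le zero_le_one] at hs
      simp only [ef hs, eτ hs]
  intro s hs hlt
  rw [eFa hs]
  refine of_continuous hb hFa hFb hTa hTb (hma.congr eTa) (hmb.congr eTb).monotoneOn
    (A := A) (B := B) (fun r hr => ?_) hB (fun ϖ hϖ => ?_) hs ?_
  · rw [← eTa hr, ← eTb hr]
    exact hbd r hr
  · rw [← hint eFa eTa, ← hint eFb eTb]
    exact hid ϖ hϖ
  · rw [← eTa hs, ← eTb h01]
    exact hlt

end Summit.KontsevichZagierPeriods.InverseLandau.TateFamilyKernel.Descent

end
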